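import Literature.NumberTheory.DiophantineGeometry.GeneralizedFermatSignatureNN2
import HarnessLib

/-!
# The cyclotomic descent for `x ^ p − y ^ p = c z ^ 2` (`c ∈ 𝔑_p`): Ivorra's and Kraus's equation
# theorems PROVED from the rational points of `y² = Φ_p(x)` and `p y² = Φ_p(x)`

Topic `Literature/NumberTheory/DiophantineGeometry`, companion of `GeneralizedFermatSignatureNN2.lean`, which
vendors as NAMED FACTS (unproved, cited): `ivorra2007_cyclotomicCurves` (W. Ivorra, Dissertationes Math. 444 (2007):
for `p ∈ {7, 11, 13, 17}` the affine rational points of `C_p : y² = Φ_p(x)` have `x ∈ {−1, 0}` and those of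
`D_p : p y² = Φ_p(x)` have `x = 1`), `ivorra2007_mainTheorem` (`x^p − y^p = c z²` has no proper non-trivial
solution for `p ∈ {11, 13, 17}`, `c ∈ 𝔑_p`), `ivorra2004_seventhPowersEqCSquare` (the same at `p = 7`, Ivorra's
thesis, announced in [IvorraKraus2006, p. 119]) and `kraus2002_seventhPowersEqCSquare` (the sub-case `7 ∣ c`,
[Kraus2002]). Here `𝔑_p` = `Ivorra2007.AdmissibleCoeff p` = square-free `c ≥ 3` all of whose prime divisors `ℓ`
satisfy `ℓ ≢ 1 (mod p)`.

CONTENT (everything PROVED, no new named fact): the classical **cyclotomic descent** by which the three equation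
theorems REDUCE to the curve theorem — this is the printed architecture of [Ivorra2007] (zbl 1116.11018: "To obtain
this result, he was led to determine the set of the ℚ-rational points of the hyperelliptic curves `C_p : y² = Φ_p(x)`
and `D_p : p y² = Φ_p(x)`") and of [Kraus2002] as described in [IvorraKraus2006, p. 119]. For an odd prime `p`,
coprime `x, y` and `Q_p(x, y) = (x^p − y^p)/(x − y) = Σ_{i<p} x^i y^{p−1−i} = y^{p−1} Φ_p(x/y)`:
* `prime_dvd_geom_sum₂_int`: a prime `ℓ ∣ Q_p(x, y)` is either `ℓ = p` (and then `ℓ ∣ x − y`) or `ℓ ≡ 1 (mod p)`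
  (and then `ℓ ∤ x − y`) — multiplicative order of `x y⁻¹ (mod ℓ)`; the `+` form is [Freitas2015, Prop. 2.3]
  ("Let `(a,b)=1` and `l ≢ 1 (mod r)` be a prime dividing `a^r + b^r`. Then `l ∣ a+b`."), `prime_dvd_add_of_dvd_pow_add_pow`;
* `sq_not_dvd_geom_sum₂_int`: `p² ∤ Q_p(x, y)` when `p ∣ x − y`, `p ∤ y` (Mathlib's `odd_sq_dvd_geom_sum₂_sub`:
  `Q_p(y + pb, y) ≡ p y^{p−1} (mod p²)`);
* `geom_sum₂_eq_sq_or_eq_prime_mul_sq`: if `c ∈ 𝔑_p` and `x^p − y^p = c z²` with `gcd(x, y, z) = 1`, `z ≠ 0`, then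
  `Q_p(x, y) = w²` or `Q_p(x, y) = p w²` (every prime of `Q_p(x, y)` other than `p` is `≡ 1 (mod p)`, hence prime to
  `c` and to `x − y`, so `Q_p(x, y)/p^{v_p} ` is a positive square by unique factorisation);
* `sub_pow_ne_mul_sq_of_cyclotomicCurves`: dividing by `y^{p−1} = (y^{(p−1)/2})²` gives a rational point
  `(x/y, w/y^{(p−1)/2})` on `C_p` or on `D_p`; `x/y ∈ {−1, 0}` resp. `x/y = 1` contradicts `xyz ≠ 0`, `c ≥ 3`.
COROLLARIES: `ivorra2007_mainTheorem_of_cyclotomicCurves`, `ivorra2004_seventhPowersEqCSquare_of_cyclotomicCurves`,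
`kraus2002_seventhPowersEqCSquare_of_cyclotomicCurves` — the three equation facts follow from the single curve fact
(which remains a cited, unproved named fact: elliptic Chabauty in print).

Design: no new definition (`Q_p(x, y)` is written as Mathlib's `∑ i ∈ range p, x ^ i * y ^ (p - 1 - i)` so that
`geom_sum₂_mul`, `dvd_geom_sum₂_iff_of_dvd_sub`, `odd_sq_dvd_geom_sum₂_sub` apply verbatim). What is NOT here: the
Chabauty computation of `C_p(ℚ)`, `D_p(ℚ)`; coefficients `c ∉ 𝔑_p` (a prime `ℓ ≡ 1 (mod p)` of `c` may divide
`Q_p(x, y)`, and the descent then lands on the twists `δ y² = Φ_p(x)`, `δ ∣ c·p` — outside every printed theorem).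
Written by the literature seat of the venture cell `pub-abcsig` (lit g14), 2026-08-25.
-/

namespace Literature.NumberTheory.DiophantineGeometry

open Finset Polynomial

/-! ## Coprimality of `x, y` from `gcd(x, y, z) = 1` and a square-free coefficient -/

/-- Two integers are coprime as soon as no prime divides both. [folklore] -/
private theorem isCoprime_of_forall_prime {a b : ℤ}
    (h : ∀ ℓ : ℕ, ℓ.Prime → (ℓ : ℤ) ∣ a → (ℓ : ℤ) ∣ b → False) : IsCoprime a b := by
  rw [Int.isCoprime_iff_gcd_eq_one]
  exact Nat.coprime_of_dvd fun k hk hka hkb => h k hk (Int.natCast_dvd.2 hka) (Int.natCast_dvd.2 hkb)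

/-- If `x ^ p − y ^ p = c z ^ 2` with `p ≥ 2`, `c` square-free and `gcd(x, y, z) = 1`, then `gcd(x, y) = 1`:
a common prime `ℓ` of `x, y` gives `ℓ² ∣ c z²`, so `ℓ ∣ z` or `ℓ² ∣ c`. [folklore] -/
private theorem isCoprime_of_sub_pow_eq_mul_sq {p : ℕ} (hp : 2 ≤ p) {c : ℕ} (hc : Squarefree c) {x y z : ℤ}
    (hg : Int.gcd (Int.gcd x y) z = 1) (heq : x ^ p - y ^ p = c * z ^ 2) : IsCoprime x y := by
  refine isCoprime_of_forall_prime fun ℓ hℓ hx hy => ?_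
  have hℓZ : Prime (ℓ : ℤ) := Nat.prime_iff_prime_int.mp hℓ
  have h2 : (ℓ : ℤ) ^ 2 ∣ (c : ℤ) * z ^ 2 := by
    rw [← heq]
    exact dvd_sub ((pow_dvd_pow _ hp).trans (pow_dvd_pow_of_dvd hx p))
      ((pow_dvd_pow _ hp).trans (pow_dvd_pow_of_dvd hy p))
  by_cases hz : (ℓ : ℤ) ∣ z
  · have h1 : ℓ ∣ Int.gcd (Int.gcd x y : ℤ) z :=
      Int.dvd_gcd (Int.natCast_dvd_natCast.mpr (Int.dvd_gcd hx hy)) hz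
    rw [hg] at h1
    exact hℓ.one_lt.ne' (Nat.dvd_one.mp h1)
  · have hcop : IsCoprime ((ℓ : ℤ) ^ 2) (z ^ 2) := ((hℓZ.coprime_iff_not_dvd).mpr hz).pow
    have h3 : (ℓ : ℤ) ^ 2 ∣ (c : ℤ) := hcop.dvd_of_dvd_mul_right h2
    have h4 : ℓ * ℓ ∣ c := by rw [← pow_two]; exact_mod_cast h3
    exact hℓ.one_lt.ne' (Nat.isUnit_iff.mp (hc ℓ h4))

/-! ## Prime divisors of `Q_p(x, y) = Σ_{i<p} x^i y^{p−1−i}` -/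

/-- A prime dividing `Q_p(x, y)` does not divide `y` (for `x, y` coprime): otherwise it divides
`x ^ p = Q_p(x, y)(x − y) + y ^ p`, hence `x`. [folklore] -/
private theorem not_dvd_of_prime_dvd_geom_sum₂ {p ℓ : ℕ} (hp : p ≠ 0) (hℓ : ℓ.Prime) {x y : ℤ}
    (hxy : IsCoprime x y) (hdvd : (ℓ : ℤ) ∣ ∑ i ∈ range p, x ^ i * y ^ (p - 1 - i)) :
    ¬ (ℓ : ℤ) ∣ y := by
  intro hy
  have hℓZ : Prime (ℓ : ℤ) := Nat.prime_iff_prime_int.mp hℓ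
  have h1 : (ℓ : ℤ) ∣ x ^ p - y ^ p := by
    rw [← geom_sum₂_mul]; exact dvd_mul_of_dvd_left hdvd _
  have h3 : (ℓ : ℤ) ∣ x ^ p := by simpa using dvd_add h1 (dvd_pow hy hp)
  exact hℓZ.not_unit (hxy.isUnit_of_dvd' (hℓZ.dvd_of_dvd_pow h3) hy)

/-- **Prime divisors of `(x^p − y^p)/(x − y)`** (`p` prime, `x, y` coprime): a prime `ℓ ∣ Σ_{i<p} x^i y^{p−1−i}`
satisfies either `ℓ = p` and `ℓ ∣ x − y`, or `ℓ ≡ 1 (mod p)` and `ℓ ∤ x − y`. (If `ℓ ∤ x − y` then `x y⁻¹` has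
multiplicative order exactly `p` modulo `ℓ`, so `p ∣ ℓ − 1`; if `ℓ ∣ x − y` then `Q_p ≡ p y^{p−1} (mod ℓ)`.)
This is [Freitas2015, Prop. 2.3] ("Let `(a,b)=1` and `l ≢ 1 (mod r)` be a prime dividing `a^r + b^r`. Then `l ∣ a+b`.")
together with the first part of [Freitas2015, Cor. 2.2] ("`a+b` and `φ_r(a,b)` are coprime outside `r`"), in the sign
variant `x^p − y^p = (x − y)·Q_p(x, y)` (`b ↦ −y`).
[cite: Freitas2015, Prop. 2.3 and Cor. 2.2 (sign variant x^p − y^p)] -/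
theorem prime_dvd_geom_sum₂_int {p ℓ : ℕ} (hp : p.Prime) (hℓ : ℓ.Prime) {x y : ℤ} (hxy : IsCoprime x y)
    (hdvd : (ℓ : ℤ) ∣ ∑ i ∈ range p, x ^ i * y ^ (p - 1 - i)) :
    (ℓ = p ∧ (ℓ : ℤ) ∣ x - y) ∨ (ℓ % p = 1 ∧ ¬ (ℓ : ℤ) ∣ x - y) := by
  have hℓZ : Prime (ℓ : ℤ) := Nat.prime_iff_prime_int.mp hℓ
  have hy : ¬ (ℓ : ℤ) ∣ y := not_dvd_of_prime_dvd_geom_sum₂ hp.ne_zero hℓ hxy hdvd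
  by_cases hd : (ℓ : ℤ) ∣ x - y
  · refine Or.inl ⟨?_, hd⟩
    have h1 : (ℓ : ℤ) ∣ (p : ℤ) * y ^ (p - 1) := (dvd_geom_sum₂_iff_of_dvd_sub hd).mp hdvd
    have h2 : (ℓ : ℤ) ∣ (p : ℤ) :=
      (hℓZ.dvd_or_dvd h1).resolve_right fun h => hy (hℓZ.dvd_of_dvd_pow h)
    exact (Nat.prime_dvd_prime_iff_eq hℓ hp).mp (Int.natCast_dvd_natCast.mp h2)
  · refine Or.inr ⟨?_, hd⟩
    haveI := Fact.mk hℓ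
    have hb : (y : ZMod ℓ) ≠ 0 := fun h => hy ((ZMod.intCast_zmod_eq_zero_iff_dvd y ℓ).mp h)
    have hab : (x : ZMod ℓ) ≠ (y : ZMod ℓ) := by
      intro h
      apply hd
      rw [← ZMod.intCast_zmod_eq_zero_iff_dvd]
      push_cast
      rw [h, sub_self]
    have hpow : (x : ZMod ℓ) ^ p = (y : ZMod ℓ) ^ p := by
      have h1 : (ℓ : ℤ) ∣ x ^ p - y ^ p := by
        rw [← geom_sum₂_mul]; exact dvd_mul_of_dvd_left hdvd _
      have h2 : ((x ^ p - y ^ p : ℤ) : ZMod ℓ) = 0 := (ZMod.intCast_zmod_eq_zero_iff_dvd _ ℓ).mpr h1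
      push_cast at h2
      exact sub_eq_zero.mp h2
    set u : ZMod ℓ := (x : ZMod ℓ) * (y : ZMod ℓ)⁻¹ with hu
    have hu1 : u ^ p = 1 := by
      rw [hu, mul_pow, hpow, ← mul_pow, mul_inv_cancel₀ hb, one_pow]
    have hune : u ≠ 1 := by
      intro h
      apply hab
      have h' : (x : ZMod ℓ) * (y : ZMod ℓ)⁻¹ * (y : ZMod ℓ) = 1 * (y : ZMod ℓ) := by rw [← hu, h]
      rwa [inv_mul_cancel_right₀ hb, one_mul] at h'
    have hu0 : u ≠ 0 := by
      intro h
      rw [h, zero_pow hp.ne_zero] at hu1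
      exact zero_ne_one hu1
    have hord : orderOf u = p :=
      (hp.eq_one_or_self_of_dvd _ (orderOf_dvd_of_pow_eq_one hu1)).resolve_left
        (fun h1 => hune (orderOf_eq_one_iff.mp h1))
    have hpd : p ∣ ℓ - 1 := hord ▸ orderOf_dvd_of_pow_eq_one (ZMod.pow_card_sub_one_eq_one hu0)
    obtain ⟨k, hk⟩ := hpd
    have hℓ2 := hℓ.two_le
    have hℓeq : ℓ = 1 + p * k := by omega
    rw [hℓeq, Nat.add_mul_mod_self_left, Nat.mod_eq_of_lt hp.one_lt]

/-- The `+` form, [Freitas2015, Prop. 2.3] verbatim: "Let `(a, b) = 1` and `l ≢ 1 (mod r)` be a prime dividing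
`a^r + b^r`. Then `l ∣ a + b`." (`r` an odd prime; `a^r + b^r = (a + b)·Q_r(a, −b)`.)
[cite: Freitas2015, Prop. 2.3] -/
theorem prime_dvd_add_of_dvd_pow_add_pow {r ℓ : ℕ} (hr : r.Prime) (hr2 : r ≠ 2) (hℓ : ℓ.Prime)
    (hℓ1 : ℓ % r ≠ 1) {a b : ℤ} (hab : IsCoprime a b) (h : (ℓ : ℤ) ∣ a ^ r + b ^ r) :
    (ℓ : ℤ) ∣ a + b := by
  have hℓZ : Prime (ℓ : ℤ) := Nat.prime_iff_prime_int.mp hℓ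
  have hodd : Odd r := hr.odd_of_ne_two hr2
  have hfac : (∑ i ∈ range r, a ^ i * (-b) ^ (r - 1 - i)) * (a + b) = a ^ r + b ^ r := by
    have := geom_sum₂_mul a (-b) r
    rwa [hodd.neg_pow, sub_neg_eq_add, sub_neg_eq_add] at this
  rw [← hfac] at h
  rcases hℓZ.dvd_or_dvd h with h1 | h1
  · rcases prime_dvd_geom_sum₂_int hr hℓ hab.neg_right h1 with ⟨-, h2⟩ | ⟨h2, -⟩
    · rwa [sub_neg_eq_add] at h2
    · exact absurd h2 hℓ1
  · exact h1

/-- `p² ∤ Q_p(x, y)` when `p` is an odd prime, `p ∣ x − y` and `p ∤ y`: writing `x = y + p b`,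
`Q_p(x, y) ≡ p y^{p−1} (mod p²)` (Mathlib's `odd_sq_dvd_geom_sum₂_sub`). This is the second part of
[Freitas2015, Cor. 2.2] ("if `r ∣ a+b` then `υ_r(φ_r(a,b)) = 1`") in the sign variant `φ_r(a, −b) = Q_r(a, b)`, kept as
the inequality `υ_p ≤ 1` that the descent uses. [cite: Freitas2015, Cor. 2.2 (second part, sign variant)] -/
theorem sq_not_dvd_geom_sum₂_int {p : ℕ} (hp : p.Prime) (hp2 : p ≠ 2) {x y : ℤ}
    (hd : (p : ℤ) ∣ x - y) (hy : ¬ (p : ℤ) ∣ y) :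
    ¬ ((p : ℤ) ^ 2 ∣ ∑ i ∈ range p, x ^ i * y ^ (p - 1 - i)) := by
  intro h
  obtain ⟨b, hb⟩ := hd
  have hx : x = y + p * b := by linear_combination hb
  have hodd : Odd p := hp.odd_of_ne_two hp2
  have key : (p : ℤ) ^ 2 ∣ (∑ i ∈ range p, (y + p * b) ^ i * y ^ (p - 1 - i)) - p * y ^ (p - 1) :=
    odd_sq_dvd_geom_sum₂_sub y b hodd
  rw [← hx] at key
  have h2 : (p : ℤ) ^ 2 ∣ (p : ℤ) * y ^ (p - 1) := by
    have := dvd_sub h key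
    rwa [sub_sub_cancel] at this
  rw [pow_two] at h2
  have hp0 : (p : ℤ) ≠ 0 := by exact_mod_cast hp.ne_zero
  have h3 : (p : ℤ) ∣ y ^ (p - 1) := (mul_dvd_mul_iff_left hp0).mp h2
  exact hy ((Nat.prime_iff_prime_int.mp hp).dvd_of_dvd_pow h3)

/-- `Q_p(x, y) > 0` for odd `p` and `x ≠ y`: `Q_p(x, y)·(x − y) = x^p − y^p` has the sign of `x − y`
(`t ↦ t^p` is strictly increasing). [folklore] -/
private theorem geom_sum₂_pos_of_ne {p : ℕ} (hodd : Odd p) {x y : ℤ} (hne : x ≠ y) :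
    0 < ∑ i ∈ range p, x ^ i * y ^ (p - 1 - i) := by
  set Q := ∑ i ∈ range p, x ^ i * y ^ (p - 1 - i) with hQ
  have hmul : Q * (x - y) = x ^ p - y ^ p := geom_sum₂_mul x y p
  have hmono : StrictMono fun t : ℤ => t ^ p := hodd.strictMono_pow
  by_contra hQ0
  have hQle : Q ≤ 0 := not_lt.mp hQ0
  rcases lt_or_gt_of_ne hne with h | h
  · have h1 : x ^ p < y ^ p := hmono h
    nlinarith [mul_nonneg_of_nonpos_of_nonpos hQle (sub_nonpos.mpr h.le)]
  · have h1 : y ^ p < x ^ p := hmono h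
    nlinarith [mul_nonpos_of_nonpos_of_nonneg hQle (sub_nonneg.mpr h.le)]

/-! ## The descent: `Q_p(x, y)` is a square or `p` times a square -/

/-- **Cyclotomic descent** ([Ivorra2007] / [Kraus2002] as described in [IvorraKraus2006, p. 119]): let `p` be an odd
prime and `c ∈ 𝔑_p` (square-free, `c ≥ 3`, every prime `ℓ ∣ c` has `ℓ ≢ 1 (mod p)`). If `x^p − y^p = c z²` with
`gcd(x, y, z) = 1` and `z ≠ 0`, then `Q_p(x, y) = Σ_{i<p} x^i y^{p−1−i}` equals `w²` or `p·w²` for some integer `w`.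
Proof: the primes of `Q_p(x, y)` other than `p` are `≡ 1 (mod p)`, hence divide neither `c` nor `x − y`; `p² ∤ Q_p(x, y)`;
so in `Q_p(x, y)·(x − y) = c z²` the `p`-free part of `Q_p(x, y)` is a positive integer coprime to its cofactor in `z²`.
[cite: Ivorra2007, reduction to C_p and D_p (as restated in zbl 1116.11018 and IvorraKraus2006 p. 119)] -/
theorem geom_sum₂_eq_sq_or_eq_prime_mul_sq {p : ℕ} (hp : p.Prime) (hp2 : p ≠ 2) {c : ℕ}
    (hc : Ivorra2007.AdmissibleCoeff p c) {x y z : ℤ} (hg : Int.gcd (Int.gcd x y) z = 1) (hz : z ≠ 0)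
    (heq : x ^ p - y ^ p = c * z ^ 2) :
    ∃ w : ℤ, (∑ i ∈ range p, x ^ i * y ^ (p - 1 - i)) = w ^ 2 ∨
      (∑ i ∈ range p, x ^ i * y ^ (p - 1 - i)) = p * w ^ 2 := by
  obtain ⟨hc3, hcsq, hcℓ⟩ := hc
  have hpZ : Prime (p : ℤ) := Nat.prime_iff_prime_int.mp hp
  have hxy : IsCoprime x y := isCoprime_of_sub_pow_eq_mul_sq hp.two_le hcsq hg heq
  set Q := ∑ i ∈ range p, x ^ i * y ^ (p - 1 - i) with hQ
  have hQmul : Q * (x - y) = c * z ^ 2 := by rw [hQ, geom_sum₂_mul, heq]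
  have hne : x ≠ y := by
    rintro rfl
    have h0 : (c : ℤ) * z ^ 2 = 0 := by rw [← heq, sub_self]
    rcases mul_eq_zero.mp h0 with h | h
    · exact absurd (by exact_mod_cast h : c = 0) (by omega)
    · exact hz (pow_eq_zero_iff two_ne_zero |>.mp h)
  have hQpos : 0 < Q := geom_sum₂_pos_of_ne (hp.odd_of_ne_two hp2) hne
  set d := x - y with hd
  -- `Q = p ^ e * Q'` with `e ≤ 1` and `p ∤ Q'`
  obtain ⟨e, Q', he, hQfac, hpQ'⟩ :
      ∃ e : ℕ, ∃ Q' : ℤ, e ≤ 1 ∧ Q = (p : ℤ) ^ e * Q' ∧ ¬ (p : ℤ) ∣ Q' := by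
    by_cases hpQ : (p : ℤ) ∣ Q
    · have hpd : (p : ℤ) ∣ x - y := by
        rcases prime_dvd_geom_sum₂_int hp hp hxy hpQ with ⟨-, h⟩ | ⟨h, -⟩
        · exact h
        · rw [Nat.mod_self] at h; exact absurd h zero_ne_one
      have hpy : ¬ (p : ℤ) ∣ y := not_dvd_of_prime_dvd_geom_sum₂ hp.ne_zero hp hxy hpQ
      have hsq : ¬ (p : ℤ) ^ 2 ∣ Q := sq_not_dvd_geom_sum₂_int hp hp2 hpd hpy
      obtain ⟨Q', hQ'⟩ := hpQ
      refine ⟨1, Q', le_rfl, by rw [pow_one]; exact hQ', fun h => hsq ?_⟩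
      obtain ⟨t, ht⟩ := h
      exact ⟨t, by rw [hQ', ht]; ring⟩
    · exact ⟨0, Q, zero_le_one, by rw [pow_zero, one_mul], hpQ⟩
  have hQ'dvd : Q' ∣ Q := ⟨(p : ℤ) ^ e, by rw [hQfac, mul_comm]⟩
  have hQ'0 : Q' ≠ 0 := by
    rintro rfl
    rw [mul_zero] at hQfac
    exact hQpos.ne' hQfac
  -- the primes of `Q'` are `≡ 1 (mod p)` and prime to `d`
  have hprime : ∀ ℓ : ℕ, ℓ.Prime → (ℓ : ℤ) ∣ Q' → ℓ % p = 1 ∧ ¬ (ℓ : ℤ) ∣ d := by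
    intro ℓ hℓ hℓQ'
    rcases prime_dvd_geom_sum₂_int hp hℓ hxy (hℓQ'.trans hQ'dvd) with ⟨rfl, -⟩ | h
    · exact absurd hℓQ' hpQ'
    · exact h
  have hcopc : IsCoprime Q' (c : ℤ) := isCoprime_of_forall_prime fun ℓ hℓ h1 h2 =>
    hcℓ ℓ hℓ (Int.natCast_dvd_natCast.mp h2) (hprime ℓ hℓ h1).1
  -- `Q' ∣ z²`, say `z² = Q' m`, and then `p^e d = c m`
  have hQ'z : Q' ∣ z ^ 2 :=
    hcopc.dvd_of_dvd_mul_left (hQmul ▸ hQ'dvd.trans (dvd_mul_right Q d))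
  obtain ⟨m, hm⟩ := hQ'z
  have hrel : (p : ℤ) ^ e * d = c * m := by
    have h1 : Q' * ((p : ℤ) ^ e * d) = Q' * (c * m) := by
      calc Q' * ((p : ℤ) ^ e * d) = Q * d := by rw [hQfac]; ring
        _ = c * z ^ 2 := hQmul
        _ = Q' * (c * m) := by rw [hm]; ring
    exact mul_left_cancel₀ hQ'0 h1
  have hcopm : IsCoprime Q' m := by
    refine isCoprime_of_forall_prime fun ℓ hℓ h1 h2 => ?_
    have hℓZ : Prime (ℓ : ℤ) := Nat.prime_iff_prime_int.mp hℓ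
    have h3 : (ℓ : ℤ) ∣ (p : ℤ) ^ e * d := by rw [hrel]; exact dvd_mul_of_dvd_right h2 _
    rcases hℓZ.dvd_or_dvd h3 with h4 | h4
    · have h5 : ℓ = p :=
        (Nat.prime_dvd_prime_iff_eq hℓ hp).mp (Int.natCast_dvd_natCast.mp (hℓZ.dvd_of_dvd_pow h4))
      subst h5
      exact hpQ' h1
    · exact (hprime ℓ hℓ h1).2 h4
  have hQ'pos : 0 < Q' := by
    have hpe : (0 : ℤ) < (p : ℤ) ^ e := pow_pos (by exact_mod_cast hp.pos) e
    rw [hQfac] at hQpos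
    exact pos_of_mul_pos_right hQpos hpe.le
  obtain ⟨w, hw⟩ : ∃ w : ℤ, Q' = w ^ 2 := by
    obtain ⟨w, hw | hw⟩ := Int.sq_of_isCoprime hcopm hm.symm
    · exact ⟨w, hw⟩
    · exfalso; nlinarith [sq_nonneg w]
  refine ⟨w, ?_⟩
  interval_cases e
  · exact Or.inl (by rw [hQfac, hw, pow_zero, one_mul])
  · exact Or.inr (by rw [hQfac, hw, pow_one])

/-! ## From the curves to the equation -/

/-- `Φ_p(x/y)·y^{p−1} = Q_p(x, y)` in `ℚ` (`p` prime, `y ≠ 0`): `Φ_p = Σ_{i<p} X^i`. [folklore] -/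
private theorem eval_cyclotomic_div_mul_pow {p : ℕ} (hp : p.Prime) (x y : ℤ) (hy : (y : ℚ) ≠ 0) :
    (cyclotomic p ℚ).eval ((x : ℚ) / y) * (y : ℚ) ^ (p - 1) =
      ((∑ i ∈ range p, x ^ i * y ^ (p - 1 - i) : ℤ) : ℚ) := by
  haveI := Fact.mk hp
  rw [cyclotomic_prime, eval_geom_sum, sum_mul]
  push_cast
  refine sum_congr rfl fun i hi => ?_
  have hi' : i ≤ p - 1 := by have := mem_range.mp hi; omega
  have hsplit : (y : ℚ) ^ (p - 1) = (y : ℚ) ^ i * (y : ℚ) ^ (p - 1 - i) := by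
    rw [← pow_add]; congr 1; omega
  rw [hsplit, div_pow, ← mul_assoc, div_mul_cancel₀ _ (pow_ne_zero i hy)]

/-- **The equation theorem from the curve theorem** (the printed reduction of [Ivorra2007], cf. [IvorraKraus2006,
p. 119]): let `p` be an odd prime such that every affine rational point of `y² = Φ_p(x)` has `x ∈ {−1, 0}` and every
affine rational point of `p y² = Φ_p(x)` has `x = 1`. Then for every `c ∈ 𝔑_p` the equation `x^p − y^p = c z²` has no
solution with `gcd(x, y, z) = 1` and `xyz ≠ 0`. (By `geom_sum₂_eq_sq_or_eq_prime_mul_sq`, `(x/y, w/y^{(p−1)/2})` is such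
a point; `x/y = 0` contradicts `x ≠ 0`, `x/y = 1` gives `z = 0`, `x/y = −1` with `gcd(x, y) = 1` gives `|x^p − y^p| = 2 < c`.)
[cite: Ivorra2007, reduction to C_p and D_p (as restated in zbl 1116.11018)] -/
theorem sub_pow_ne_mul_sq_of_cyclotomicCurves {p : ℕ} (hp : p.Prime) (hp2 : p ≠ 2)
    (hC : ∀ X Y : ℚ, Y ^ 2 = (cyclotomic p ℚ).eval X → X = -1 ∨ X = 0)
    (hD : ∀ X Y : ℚ, (p : ℚ) * Y ^ 2 = (cyclotomic p ℚ).eval X → X = 1)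
    {c : ℕ} (hc : Ivorra2007.AdmissibleCoeff p c) {x y z : ℤ}
    (hg : Int.gcd (Int.gcd x y) z = 1) (hnz : x * y * z ≠ 0) :
    x ^ p - y ^ p ≠ (c : ℤ) * z ^ 2 := by
  intro heq
  obtain ⟨hx, hy, hz⟩ : x ≠ 0 ∧ y ≠ 0 ∧ z ≠ 0 := by
    simpa only [mul_ne_zero_iff, and_assoc] using hnz
  obtain ⟨w, hw⟩ := geom_sum₂_eq_sq_or_eq_prime_mul_sq hp hp2 hc hg hz heq
  obtain ⟨k, hk⟩ : ∃ k : ℕ, p - 1 = 2 * k := by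
    obtain ⟨m, hm⟩ := hp.odd_of_ne_two hp2; exact ⟨m, by omega⟩
  have hyQ : (y : ℚ) ≠ 0 := by exact_mod_cast hy
  set X : ℚ := (x : ℚ) / y with hX
  set Y : ℚ := (w : ℚ) / (y : ℚ) ^ k with hY
  have hΦ := eval_cyclotomic_div_mul_pow hp x y hyQ
  have hYsq : Y ^ 2 * (y : ℚ) ^ (p - 1) = (w : ℚ) ^ 2 := by
    rw [hY, hk, div_pow, ← pow_mul, mul_comm k 2, div_mul_cancel₀ _ (pow_ne_zero _ hyQ)]
  have hypow : (y : ℚ) ^ (p - 1) ≠ 0 := pow_ne_zero _ hyQ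
  rcases hw with hQ | hQ
  · -- a point on `C_p`
    have hcurve : Y ^ 2 = (cyclotomic p ℚ).eval X := by
      apply mul_right_cancel₀ hypow
      rw [hYsq, hX, hΦ, hQ]; push_cast; ring
    rcases hC X Y hcurve with hX1 | hX0
    · have hxyQ : (x : ℚ) = -y := by
        have h' := hX1; rw [hX, div_eq_iff hyQ] at h'; linear_combination h'
      have hxyZ : x = -y := by exact_mod_cast hxyQ
      have hcop : IsCoprime x y := isCoprime_of_sub_pow_eq_mul_sq hp.two_le hc.2.1 hg heq
      rw [hxyZ, IsCoprime.neg_left_iff, isCoprime_self] at hcop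
      have hodd : Odd p := hp.odd_of_ne_two hp2
      have hc3 : (3 : ℤ) ≤ c := by exact_mod_cast hc.1
      have hz2 : 1 ≤ z ^ 2 := by
        have := sq_pos_of_ne_zero hz  -- hmm order of args
        omega
      rcases Int.isUnit_iff.mp hcop with hy1 | hy1
      · rw [hxyZ, hy1, hodd.neg_one_pow, one_pow] at heq
        nlinarith
      · rw [hxyZ, hy1, neg_neg, one_pow, hodd.neg_one_pow] at heq
        nlinarith
    · have hx0 : (x : ℚ) = 0 := by
        have h' := hX0; rwa [hX, div_eq_zero_iff, or_iff_left hyQ] at h'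
      exact hx (by exact_mod_cast hx0)
  · -- a point on `D_p`
    have hcurve : (p : ℚ) * Y ^ 2 = (cyclotomic p ℚ).eval X := by
      apply mul_right_cancel₀ hypow
      rw [mul_assoc, hYsq, hX, hΦ, hQ]; push_cast; ring
    have hX1 := hD X Y hcurve
    have hxyQ : (x : ℚ) = y := by
      rw [hX, div_eq_iff hyQ, one_mul] at hX1; exact hX1
    have hxyZ : x = y := by exact_mod_cast hxyQ
    rw [hxyZ, sub_self] at heq
    have hc0 : (c : ℤ) ≠ 0 := by have := hc.1; positivity
    exact (mul_ne_zero hc0 (pow_ne_zero 2 hz)) heq.symm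

/-! ## Corollaries: the three vendored equation facts follow from `ivorra2007_cyclotomicCurves` -/

/-- **Ivorra 2004 (thesis, `p = 7`, all `c ∈ 𝔑₇`) from the curve fact**: `ivorra2007_cyclotomicCurves` (which
includes `p = 7`: "These equalities are also valid if `p = 7`", zbl 1116.11018) implies
`ivorra2004_seventhPowersEqCSquare`. [cite: Ivorra2007, C_7(ℚ), D_7(ℚ) ⇒ S_7(c) = ∅ (zbl 1116.11018; IvorraKraus2006 p. 119)] -/
theorem ivorra2004_seventhPowersEqCSquare_of_cyclotomicCurves (h : ivorra2007_cyclotomicCurves) :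
    ivorra2004_seventhPowersEqCSquare := fun _c hc _x _y _z hg hnz =>
  sub_pow_ne_mul_sq_of_cyclotomicCurves Nat.prime_seven (by norm_num)
    (fun X Y hXY => ((h 7 (by simp) X Y).1 hXY).1) (fun X Y hXY => ((h 7 (by simp) X Y).2 hXY).1) hc hg hnz

/-- **Ivorra 2007, main theorem (`p ∈ {11, 13, 17}`, all `c ∈ 𝔑_p`) from the curve fact.**
[cite: Ivorra2007, main theorem via C_p(ℚ), D_p(ℚ) (zbl 1116.11018; RatcliffeGrechuk2024 Thm 4.31)] -/
theorem ivorra2007_mainTheorem_of_cyclotomicCurves (h : ivorra2007_cyclotomicCurves) :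
    ivorra2007_mainTheorem := by
  intro p hp c hc x y z hg hnz
  have hp' : p ∈ ({7, 11, 13, 17} : Finset ℕ) := by
    simp only [Finset.mem_insert, Finset.mem_singleton] at hp ⊢; tauto
  have hprime : p.Prime ∧ p ≠ 2 := by
    simp only [Finset.mem_insert, Finset.mem_singleton] at hp
    rcases hp with rfl | rfl | rfl <;> exact ⟨by norm_num, by norm_num⟩
  exact sub_pow_ne_mul_sq_of_cyclotomicCurves hprime.1 hprime.2
    (fun X Y hXY => ((h p hp' X Y).1 hXY).1) (fun X Y hXY => ((h p hp' X Y).2 hXY).1) hc hg hnz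

/-- **Kraus 2002 (`p = 7`, `7 ∣ c ∈ 𝔑₇`) from the curve fact** (via `ivorra2004_seventhPowersEqCSquare.toKraus2002`).
[cite: Kraus2002, (m,n) = (7,2) (as restated in RatcliffeGrechuk2024 Thm 4.19(2); reduction per IvorraKraus2006 p. 119)] -/
theorem kraus2002_seventhPowersEqCSquare_of_cyclotomicCurves (h : ivorra2007_cyclotomicCurves) :
    kraus2002_seventhPowersEqCSquare :=
  (ivorra2004_seventhPowersEqCSquare_of_cyclotomicCurves h).toKraus2002

/-! ## The cited cells of the census rows at `c = 38` and `c = 23` from the ONE curve fact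

Appended 2026-08-25 (lit seat g16 of the venture cell `pub-abcsig`, 0 new facts). Section `CoefficientThirtyEight` of
`GeneralizedFermatSignatureNN2` proves `38 ∈ 𝔑_p` for `p ∈ {7, 11, 13, 17}` and `23 ∈ 𝔑₇ ∩ 𝔑₁₃ ∩ 𝔑₁₇` (`23 ∉ 𝔑₁₁`)
and states the corresponding cells of the rows `xⁿ + yⁿ = 38 z²` (level `2⁸·19²`) and `xⁿ + yⁿ = 23 z²` (level `2⁵·23²`)
from the two EQUATION facts. Combined with the corollaries above, those cells follow from Ivorra's determination of
`C_p(ℚ)` and `D_p(ℚ)` ALONE (`ivorra2007_cyclotomicCurves`, elliptic Chabauty in print) — the descent in between is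
kernel-checked. Nothing here concerns the other exponents of either row. -/

/-- **`x^p + y^p ≠ 38 z²` for every `p ∈ {7, 11, 13, 17}`** and all `(x, y, z) ∈ ℤ³` with `gcd(x, y, z) = 1`, `xyz ≠ 0`,
GIVEN only the curve fact `ivorra2007_cyclotomicCurves`.
[cite: Ivorra2007, C_p(ℚ), D_p(ℚ) ⇒ S_p(38) = ∅, p ∈ {7, 11, 13, 17} (zbl 1116.11018; IvorraKraus2006 p. 119)] -/
theorem sum_pow_ne_thirtyEight_mul_sq_of_cyclotomicCurves (h : ivorra2007_cyclotomicCurves) {p : ℕ}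
    (hp : p ∈ ({7, 11, 13, 17} : Finset ℕ)) {x y z : ℤ} (hg : Int.gcd (Int.gcd x y) z = 1)
    (hnz : x * y * z ≠ 0) : x ^ p + y ^ p ≠ 38 * z ^ 2 :=
  sum_pow_ne_thirtyEight_mul_sq_of_ivorra (ivorra2004_seventhPowersEqCSquare_of_cyclotomicCurves h)
    (ivorra2007_mainTheorem_of_cyclotomicCurves h) hp hg hnz

/-- The same in the census row's printed shape (nonzero pairwise coprime `x, y, z`; only `gcd(x, y) = 1` is used).
[cite: Ivorra2007, C_p(ℚ), D_p(ℚ) ⇒ S_p(38) = ∅ (pairwise-coprime form; zbl 1116.11018)] -/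
theorem sum_pow_ne_thirtyEight_mul_sq_of_cyclotomicCurves' (h : ivorra2007_cyclotomicCurves) {p : ℕ}
    (hp : p ∈ ({7, 11, 13, 17} : Finset ℕ)) {x y z : ℤ} (hx : x ≠ 0) (hy : y ≠ 0) (hz : z ≠ 0)
    (hxy : IsCoprime x y) : x ^ p + y ^ p ≠ 38 * z ^ 2 := by
  refine sum_pow_ne_thirtyEight_mul_sq_of_cyclotomicCurves h hp ?_ (mul_ne_zero (mul_ne_zero hx hy) hz)
  rw [Int.isCoprime_iff_gcd_eq_one.mp hxy]
  exact Int.gcd_one_left z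

/-- **`x^p + y^p ≠ 23 z²` for every `p ∈ {7, 13, 17}`** (proper non-trivial), GIVEN only the curve fact; `p = 11` is
outside [Ivorra2007] since `23 ≡ 1 (mod 11)` (`Ivorra2007.not_admissibleCoeff_eleven_twentyThree`).
[cite: Ivorra2007, C_p(ℚ), D_p(ℚ) ⇒ S_p(23) = ∅, p ∈ {7, 13, 17} (zbl 1116.11018; IvorraKraus2006 p. 119)] -/
theorem sum_pow_ne_twentyThree_mul_sq_of_cyclotomicCurves (h : ivorra2007_cyclotomicCurves) {p : ℕ}
    (hp : p = 7 ∨ p = 13 ∨ p = 17) {x y z : ℤ} (hg : Int.gcd (Int.gcd x y) z = 1)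
    (hnz : x * y * z ≠ 0) : x ^ p + y ^ p ≠ 23 * z ^ 2 := by
  rcases hp with rfl | hp
  · exact ivorra2004_seventhPowersEqCSquare.twentyThree (ivorra2004_seventhPowersEqCSquare_of_cyclotomicCurves h) hg hnz
  · exact ivorra2007_mainTheorem.twentyThree (ivorra2007_mainTheorem_of_cyclotomicCurves h) hp hg hnz

/-- The same in the census row's printed shape (nonzero pairwise coprime `x, y, z`).
[cite: Ivorra2007, C_p(ℚ), D_p(ℚ) ⇒ S_p(23) = ∅ (pairwise-coprime form; zbl 1116.11018)] -/
theorem sum_pow_ne_twentyThree_mul_sq_of_cyclotomicCurves' (h : ivorra2007_cyclotomicCurves) {p : ℕ}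
    (hp : p = 7 ∨ p = 13 ∨ p = 17) {x y z : ℤ} (hx : x ≠ 0) (hy : y ≠ 0) (hz : z ≠ 0)
    (hxy : IsCoprime x y) : x ^ p + y ^ p ≠ 23 * z ^ 2 := by
  refine sum_pow_ne_twentyThree_mul_sq_of_cyclotomicCurves h hp ?_ (mul_ne_zero (mul_ne_zero hx hy) hz)
  rw [Int.isCoprime_iff_gcd_eq_one.mp hxy]
  exact Int.gcd_one_left z

/-! ## The census coefficients: `𝔑_p`-memberships and the cited cells from the ONE curve fact (generic form)

Appended 2026-08-25 (lit seat g17 of the venture cell `pub-abcsig`, 0 new facts). The cell's rows `xⁿ + yⁿ = C z²`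
cite, AS PRINTED, [Ivorra2007] at `n ∈ {11, 13, 17}` (`C ∈ 𝔑_n`; Ratcliffe–Grechuk 2024 Thm 4.31, verbatim in
`GeneralizedFermatSignatureNN2`) and at `n = 7` the thesis theorem announced in [IvorraKraus2006, p. 119] (`C ∈ 𝔑₇`).
This section serves the coefficients of the rows written on 2026-08-25/26 — the `xy`-odd halves `C ∈ {31, 33, 35, 37,
39, 43, 47}` (levels `2⁵C²`), the `n = 7` revisions `C ∈ {19, 22, 37, 53, 59}`, and `C = 29` — with:
(i) the GENERIC cited cell `sum_pow_ne_mul_sq_of_cyclotomicCurves`: for `p ∈ {7, 11, 13, 17}` and `c ∈ 𝔑_p`,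
`x^p + y^p ≠ c z²` for every proper non-trivial `(x, y, z)`, GIVEN only `ivorra2007_cyclotomicCurves` (the descent is
`sub_pow_ne_mul_sq_of_cyclotomicCurves` above; row shape: the primed form);
(ii) the memberships `C ∈ 𝔑_p`, PROVED by the list criterion `Ivorra2007.admissibleCoeff_iff_primeFactorsList`, stated
for exactly the exponents `p ∈ {7, 11, 13, 17}` with `p ∤ C` at which they hold, and the two boundary NON-memberships
among these coefficients — `43 ∉ 𝔑₇` (`43 ≡ 1 mod 7`) and `53 ∉ 𝔑₁₃` (`53 ≡ 1 mod 13`): at those cells neither printed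
theorem applies and a row closing them cannot cite [Ivorra2007] / the thesis (venture-cell lit rule §F-C33-n7);
(iii) one named cell per coefficient (proper non-trivial form; the row shape follows from (i)').
Exponents dividing `C` are left out on purpose (the rows exclude `n ∣ C`). Nothing here concerns the other exponents
of any row (those are the cell's certificates), and nothing is proved about the curve fact itself.
-/

section CensusCoefficients

/-- **Generic cited cell.** For `p ∈ {7, 11, 13, 17}` and `c ∈ 𝔑_p`: `x^p + y^p ≠ c z²` whenever `gcd(x, y, z) = 1`
and `xyz ≠ 0`, GIVEN Ivorra's determination of `C_p(ℚ)` and `D_p(ℚ)` (`ivorra2007_cyclotomicCurves`): `p = 7` through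
`ivorra2004_seventhPowersEqCSquare_of_cyclotomicCurves`, `p ∈ {11, 13, 17}` through
`ivorra2007_mainTheorem_of_cyclotomicCurves` (both `+` forms by `y ↦ −y`).
[cite: Ivorra2007, C_p(ℚ), D_p(ℚ) ⇒ S_p(c) = ∅ for c ∈ 𝔑_p, p ∈ {7, 11, 13, 17} (zbl 1116.11018; IvorraKraus2006 p. 119; RatcliffeGrechuk2024 Thm 4.31)] -/
theorem sum_pow_ne_mul_sq_of_cyclotomicCurves (h : ivorra2007_cyclotomicCurves) {p : ℕ}
    (hp : p ∈ ({7, 11, 13, 17} : Finset ℕ)) {c : ℕ} (hc : Ivorra2007.AdmissibleCoeff p c) {x y z : ℤ}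
    (hg : Int.gcd (Int.gcd x y) z = 1) (hnz : x * y * z ≠ 0) : x ^ p + y ^ p ≠ (c : ℤ) * z ^ 2 := by
  by_cases hp7 : p = 7
  · subst hp7
    exact (ivorra2004_seventhPowersEqCSquare_of_cyclotomicCurves h).sum_form hc hg hnz
  · have hp' : p ∈ ({11, 13, 17} : Finset ℕ) := by
      simp only [Finset.mem_insert, Finset.mem_singleton] at hp ⊢; tauto
    exact (ivorra2007_mainTheorem_of_cyclotomicCurves h).sum_form p hp' c hc x y z hg hnz

/-- The generic cited cell in the census rows' printed shape (nonzero pairwise coprime `x, y, z`; only `gcd(x, y) = 1`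
is used). [cite: Ivorra2007, C_p(ℚ), D_p(ℚ) ⇒ S_p(c) = ∅ for c ∈ 𝔑_p (pairwise-coprime form; zbl 1116.11018)] -/
theorem sum_pow_ne_mul_sq_of_cyclotomicCurves' (h : ivorra2007_cyclotomicCurves) {p : ℕ}
    (hp : p ∈ ({7, 11, 13, 17} : Finset ℕ)) {c : ℕ} (hc : Ivorra2007.AdmissibleCoeff p c) {x y z : ℤ}
    (hx : x ≠ 0) (hy : y ≠ 0) (hz : z ≠ 0) (hxy : IsCoprime x y) : x ^ p + y ^ p ≠ (c : ℤ) * z ^ 2 := by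
  refine sum_pow_ne_mul_sq_of_cyclotomicCurves h hp hc ?_ (mul_ne_zero (mul_ne_zero hx hy) hz)
  rw [Int.isCoprime_iff_gcd_eq_one.mp hxy]
  exact Int.gcd_one_left z

/-- `19 ∈ 𝔑_p` for every `p ∈ {7, 11, 13, 17}` (prime; residues `19 ≡ 5` `(mod 7)`; `19 ≡ 8` `(mod 11)`; `19 ≡ 6` `(mod 13)`; `19 ≡ 2` `(mod 17)`): rows `C1-C19-even` / `C1-C19-odd` (levels `2·19²`, `2⁵·19²`).
[cite: IvorraKraus2006, p. 119; Ivorra2007, main theorem hypothesis (RatcliffeGrechuk2024 Thm 4.31) (membership 19 ∈ 𝔑_p)] -/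
theorem Ivorra2007.admissibleCoeff_nineteen_of_mem {p : ℕ} (hp : p ∈ ({7, 11, 13, 17} : Finset ℕ)) :
    Ivorra2007.AdmissibleCoeff p 19 := by
  simp only [Finset.mem_insert, Finset.mem_singleton] at hp
  rcases hp with rfl | rfl | rfl | rfl <;> (rw [Ivorra2007.admissibleCoeff_iff_primeFactorsList]; simp)

/-- **The cited cells `x^p + y^p ≠ 19 z²`, `p ∈ {7, 11, 13, 17}`**, for all `(x, y, z)` with `gcd(x, y, z) = 1` and `xyz ≠ 0`,
GIVEN only the curve fact (rows `C1-C19-even` / `C1-C19-odd` (levels `2·19²`, `2⁵·19²`)). Row shape: `sum_pow_ne_mul_sq_of_cyclotomicCurves'` with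
`Ivorra2007.admissibleCoeff_nineteen_of_mem`. [cite: Ivorra2007, C_p(ℚ), D_p(ℚ) ⇒ S_p(19) = ∅, p ∈ {7, 11, 13, 17} (zbl 1116.11018; IvorraKraus2006 p. 119; RatcliffeGrechuk2024 Thm 4.31)] -/
theorem sum_pow_ne_nineteen_mul_sq_of_cyclotomicCurves (h : ivorra2007_cyclotomicCurves) {p : ℕ}
    (hp : p ∈ ({7, 11, 13, 17} : Finset ℕ)) {x y z : ℤ} (hg : Int.gcd (Int.gcd x y) z = 1)
    (hnz : x * y * z ≠ 0) : x ^ p + y ^ p ≠ 19 * z ^ 2 := by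
  exact_mod_cast sum_pow_ne_mul_sq_of_cyclotomicCurves h hp (Ivorra2007.admissibleCoeff_nineteen_of_mem hp) hg hnz

/-- `22 ∈ 𝔑_p` for every `p ∈ {7, 13, 17}` (`22 = 2·11`; residues `2 ≡ 2, 11 ≡ 4` `(mod 7)`; `2 ≡ 2, 11 ≡ 11` `(mod 13)`; `2 ≡ 2, 11 ≡ 11` `(mod 17)`): row `C1-C22-all` (levels `2⁸·11²`; `n = 11 ∣ C` excluded by the row).
[cite: IvorraKraus2006, p. 119; Ivorra2007, main theorem hypothesis (RatcliffeGrechuk2024 Thm 4.31) (membership 22 ∈ 𝔑_p)] -/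
theorem Ivorra2007.admissibleCoeff_twentyTwo_of_mem {p : ℕ} (hp : p ∈ ({7, 13, 17} : Finset ℕ)) :
    Ivorra2007.AdmissibleCoeff p 22 := by
  simp only [Finset.mem_insert, Finset.mem_singleton] at hp
  rcases hp with rfl | rfl | rfl <;> (rw [Ivorra2007.admissibleCoeff_iff_primeFactorsList]; simp)

/-- **The cited cells `x^p + y^p ≠ 22 z²`, `p ∈ {7, 13, 17}`**, for all `(x, y, z)` with `gcd(x, y, z) = 1` and `xyz ≠ 0`,
GIVEN only the curve fact (row `C1-C22-all` (levels `2⁸·11²`; `n = 11 ∣ C` excluded by the row)). Row shape: `sum_pow_ne_mul_sq_of_cyclotomicCurves'` with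
`Ivorra2007.admissibleCoeff_twentyTwo_of_mem`. [cite: Ivorra2007, C_p(ℚ), D_p(ℚ) ⇒ S_p(22) = ∅, p ∈ {7, 13, 17} (zbl 1116.11018; IvorraKraus2006 p. 119; RatcliffeGrechuk2024 Thm 4.31)] -/
theorem sum_pow_ne_twentyTwo_mul_sq_of_cyclotomicCurves (h : ivorra2007_cyclotomicCurves) {p : ℕ}
    (hp : p ∈ ({7, 13, 17} : Finset ℕ)) {x y z : ℤ} (hg : Int.gcd (Int.gcd x y) z = 1)
    (hnz : x * y * z ≠ 0) : x ^ p + y ^ p ≠ 22 * z ^ 2 := by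
  have hp' : p ∈ ({7, 11, 13, 17} : Finset ℕ) := by
    simp only [Finset.mem_insert, Finset.mem_singleton] at hp ⊢; tauto
  exact_mod_cast sum_pow_ne_mul_sq_of_cyclotomicCurves h hp' (Ivorra2007.admissibleCoeff_twentyTwo_of_mem hp) hg hnz

/-- `29 ∈ 𝔑_p` for every `p ∈ {11, 13, 17}` (prime; residues `29 ≡ 7` `(mod 11)`; `29 ≡ 3` `(mod 13)`; `29 ≡ 12` `(mod 17)`): rows `C1-C29-even` / `C1-C29-odd` (levels `2·29²`, `2⁵·29²`); `29 ∉ 𝔑₇` is `Ivorra2007.not_admissibleCoeff_seven_twentyNine`.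
[cite: Ivorra2007, main theorem hypothesis (RatcliffeGrechuk2024 Thm 4.31) (membership 29 ∈ 𝔑_p)] -/
theorem Ivorra2007.admissibleCoeff_twentyNine_of_mem {p : ℕ} (hp : p ∈ ({11, 13, 17} : Finset ℕ)) :
    Ivorra2007.AdmissibleCoeff p 29 := by
  simp only [Finset.mem_insert, Finset.mem_singleton] at hp
  rcases hp with rfl | rfl | rfl <;> (rw [Ivorra2007.admissibleCoeff_iff_primeFactorsList]; simp)

/-- **The cited cells `x^p + y^p ≠ 29 z²`, `p ∈ {11, 13, 17}`**, for all `(x, y, z)` with `gcd(x, y, z) = 1` and `xyz ≠ 0`,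
GIVEN only the curve fact (rows `C1-C29-even` / `C1-C29-odd` (levels `2·29²`, `2⁵·29²`); `29 ∉ 𝔑₇` is `Ivorra2007.not_admissibleCoeff_seven_twentyNine`). Row shape: `sum_pow_ne_mul_sq_of_cyclotomicCurves'` with
`Ivorra2007.admissibleCoeff_twentyNine_of_mem`. [cite: Ivorra2007, C_p(ℚ), D_p(ℚ) ⇒ S_p(29) = ∅, p ∈ {11, 13, 17} (zbl 1116.11018; RatcliffeGrechuk2024 Thm 4.31)] -/
theorem sum_pow_ne_twentyNine_mul_sq_of_cyclotomicCurves (h : ivorra2007_cyclotomicCurves) {p : ℕ}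
    (hp : p ∈ ({11, 13, 17} : Finset ℕ)) {x y z : ℤ} (hg : Int.gcd (Int.gcd x y) z = 1)
    (hnz : x * y * z ≠ 0) : x ^ p + y ^ p ≠ 29 * z ^ 2 := by
  have hp' : p ∈ ({7, 11, 13, 17} : Finset ℕ) := by
    simp only [Finset.mem_insert, Finset.mem_singleton] at hp ⊢; tauto
  exact_mod_cast sum_pow_ne_mul_sq_of_cyclotomicCurves h hp' (Ivorra2007.admissibleCoeff_twentyNine_of_mem hp) hg hnz

/-- `31 ∈ 𝔑_p` for every `p ∈ {7, 11, 13, 17}` (prime; residues `31 ≡ 3` `(mod 7)`; `31 ≡ 9` `(mod 11)`; `31 ≡ 5` `(mod 13)`; `31 ≡ 14` `(mod 17)`): rows `C1-C31-even` / `C1-C31-odd` (levels `2·31²`, `2⁵·31²`).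
[cite: IvorraKraus2006, p. 119; Ivorra2007, main theorem hypothesis (RatcliffeGrechuk2024 Thm 4.31) (membership 31 ∈ 𝔑_p)] -/
theorem Ivorra2007.admissibleCoeff_thirtyOne_of_mem {p : ℕ} (hp : p ∈ ({7, 11, 13, 17} : Finset ℕ)) :
    Ivorra2007.AdmissibleCoeff p 31 := by
  simp only [Finset.mem_insert, Finset.mem_singleton] at hp
  rcases hp with rfl | rfl | rfl | rfl <;> (rw [Ivorra2007.admissibleCoeff_iff_primeFactorsList]; simp)

/-- **The cited cells `x^p + y^p ≠ 31 z²`, `p ∈ {7, 11, 13, 17}`**, for all `(x, y, z)` with `gcd(x, y, z) = 1` and `xyz ≠ 0`,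
GIVEN only the curve fact (rows `C1-C31-even` / `C1-C31-odd` (levels `2·31²`, `2⁵·31²`)). Row shape: `sum_pow_ne_mul_sq_of_cyclotomicCurves'` with
`Ivorra2007.admissibleCoeff_thirtyOne_of_mem`. [cite: Ivorra2007, C_p(ℚ), D_p(ℚ) ⇒ S_p(31) = ∅, p ∈ {7, 11, 13, 17} (zbl 1116.11018; IvorraKraus2006 p. 119; RatcliffeGrechuk2024 Thm 4.31)] -/
theorem sum_pow_ne_thirtyOne_mul_sq_of_cyclotomicCurves (h : ivorra2007_cyclotomicCurves) {p : ℕ}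
    (hp : p ∈ ({7, 11, 13, 17} : Finset ℕ)) {x y z : ℤ} (hg : Int.gcd (Int.gcd x y) z = 1)
    (hnz : x * y * z ≠ 0) : x ^ p + y ^ p ≠ 31 * z ^ 2 := by
  exact_mod_cast sum_pow_ne_mul_sq_of_cyclotomicCurves h hp (Ivorra2007.admissibleCoeff_thirtyOne_of_mem hp) hg hnz

/-- `33 ∈ 𝔑_p` for every `p ∈ {7, 13, 17}` (`33 = 3·11`; residues `3 ≡ 3, 11 ≡ 4` `(mod 7)`; `3 ≡ 3, 11 ≡ 11` `(mod 13)`; `3 ≡ 3, 11 ≡ 11` `(mod 17)`): rows `C1-C33-even` / `C1-C33-odd` (levels `2·33²`, `2⁵·33²`; `n = 11 ∣ C` excluded by the rows).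
[cite: IvorraKraus2006, p. 119; Ivorra2007, main theorem hypothesis (RatcliffeGrechuk2024 Thm 4.31) (membership 33 ∈ 𝔑_p)] -/
theorem Ivorra2007.admissibleCoeff_thirtyThree_of_mem {p : ℕ} (hp : p ∈ ({7, 13, 17} : Finset ℕ)) :
    Ivorra2007.AdmissibleCoeff p 33 := by
  simp only [Finset.mem_insert, Finset.mem_singleton] at hp
  rcases hp with rfl | rfl | rfl <;> (rw [Ivorra2007.admissibleCoeff_iff_primeFactorsList]; simp)

/-- **The cited cells `x^p + y^p ≠ 33 z²`, `p ∈ {7, 13, 17}`**, for all `(x, y, z)` with `gcd(x, y, z) = 1` and `xyz ≠ 0`,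
GIVEN only the curve fact (rows `C1-C33-even` / `C1-C33-odd` (levels `2·33²`, `2⁵·33²`; `n = 11 ∣ C` excluded by the rows)). Row shape: `sum_pow_ne_mul_sq_of_cyclotomicCurves'` with
`Ivorra2007.admissibleCoeff_thirtyThree_of_mem`. [cite: Ivorra2007, C_p(ℚ), D_p(ℚ) ⇒ S_p(33) = ∅, p ∈ {7, 13, 17} (zbl 1116.11018; IvorraKraus2006 p. 119; RatcliffeGrechuk2024 Thm 4.31)] -/
theorem sum_pow_ne_thirtyThree_mul_sq_of_cyclotomicCurves (h : ivorra2007_cyclotomicCurves) {p : ℕ}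
    (hp : p ∈ ({7, 13, 17} : Finset ℕ)) {x y z : ℤ} (hg : Int.gcd (Int.gcd x y) z = 1)
    (hnz : x * y * z ≠ 0) : x ^ p + y ^ p ≠ 33 * z ^ 2 := by
  have hp' : p ∈ ({7, 11, 13, 17} : Finset ℕ) := by
    simp only [Finset.mem_insert, Finset.mem_singleton] at hp ⊢; tauto
  exact_mod_cast sum_pow_ne_mul_sq_of_cyclotomicCurves h hp' (Ivorra2007.admissibleCoeff_thirtyThree_of_mem hp) hg hnz

/-- `35 ∈ 𝔑_p` for every `p ∈ {11, 13, 17}` (`35 = 5·7`; residues `5 ≡ 5, 7 ≡ 7` `(mod 11)`; `5 ≡ 5, 7 ≡ 7` `(mod 13)`; `5 ≡ 5, 7 ≡ 7` `(mod 17)`): rows `C1-C35-even` / `C1-C35-odd` (levels `2·35²`, `2⁵·35²`; `n = 7 ∣ C` excluded by the rows — that cell is [Kraus2002]).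
[cite: Ivorra2007, main theorem hypothesis (RatcliffeGrechuk2024 Thm 4.31) (membership 35 ∈ 𝔑_p)] -/
theorem Ivorra2007.admissibleCoeff_thirtyFive_of_mem {p : ℕ} (hp : p ∈ ({11, 13, 17} : Finset ℕ)) :
    Ivorra2007.AdmissibleCoeff p 35 := by
  simp only [Finset.mem_insert, Finset.mem_singleton] at hp
  rcases hp with rfl | rfl | rfl <;> (rw [Ivorra2007.admissibleCoeff_iff_primeFactorsList]; simp)

/-- **The cited cells `x^p + y^p ≠ 35 z²`, `p ∈ {11, 13, 17}`**, for all `(x, y, z)` with `gcd(x, y, z) = 1` and `xyz ≠ 0`,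
GIVEN only the curve fact (rows `C1-C35-even` / `C1-C35-odd` (levels `2·35²`, `2⁵·35²`; `n = 7 ∣ C` excluded by the rows — that cell is [Kraus2002])). Row shape: `sum_pow_ne_mul_sq_of_cyclotomicCurves'` with
`Ivorra2007.admissibleCoeff_thirtyFive_of_mem`. [cite: Ivorra2007, C_p(ℚ), D_p(ℚ) ⇒ S_p(35) = ∅, p ∈ {11, 13, 17} (zbl 1116.11018; RatcliffeGrechuk2024 Thm 4.31)] -/
theorem sum_pow_ne_thirtyFive_mul_sq_of_cyclotomicCurves (h : ivorra2007_cyclotomicCurves) {p : ℕ}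
    (hp : p ∈ ({11, 13, 17} : Finset ℕ)) {x y z : ℤ} (hg : Int.gcd (Int.gcd x y) z = 1)
    (hnz : x * y * z ≠ 0) : x ^ p + y ^ p ≠ 35 * z ^ 2 := by
  have hp' : p ∈ ({7, 11, 13, 17} : Finset ℕ) := by
    simp only [Finset.mem_insert, Finset.mem_singleton] at hp ⊢; tauto
  exact_mod_cast sum_pow_ne_mul_sq_of_cyclotomicCurves h hp' (Ivorra2007.admissibleCoeff_thirtyFive_of_mem hp) hg hnz

/-- `37 ∈ 𝔑_p` for every `p ∈ {7, 11, 13, 17}` (prime; residues `37 ≡ 2` `(mod 7)`; `37 ≡ 4` `(mod 11)`; `37 ≡ 11` `(mod 13)`; `37 ≡ 3` `(mod 17)`): rows `C1-C37-even` / `C1-C37-odd` (levels `2·37²`, `2⁵·37²`).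
[cite: IvorraKraus2006, p. 119; Ivorra2007, main theorem hypothesis (RatcliffeGrechuk2024 Thm 4.31) (membership 37 ∈ 𝔑_p)] -/
theorem Ivorra2007.admissibleCoeff_thirtySeven_of_mem {p : ℕ} (hp : p ∈ ({7, 11, 13, 17} : Finset ℕ)) :
    Ivorra2007.AdmissibleCoeff p 37 := by
  simp only [Finset.mem_insert, Finset.mem_singleton] at hp
  rcases hp with rfl | rfl | rfl | rfl <;> (rw [Ivorra2007.admissibleCoeff_iff_primeFactorsList]; simp)

/-- **The cited cells `x^p + y^p ≠ 37 z²`, `p ∈ {7, 11, 13, 17}`**, for all `(x, y, z)` with `gcd(x, y, z) = 1` and `xyz ≠ 0`,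
GIVEN only the curve fact (rows `C1-C37-even` / `C1-C37-odd` (levels `2·37²`, `2⁵·37²`)). Row shape: `sum_pow_ne_mul_sq_of_cyclotomicCurves'` with
`Ivorra2007.admissibleCoeff_thirtySeven_of_mem`. [cite: Ivorra2007, C_p(ℚ), D_p(ℚ) ⇒ S_p(37) = ∅, p ∈ {7, 11, 13, 17} (zbl 1116.11018; IvorraKraus2006 p. 119; RatcliffeGrechuk2024 Thm 4.31)] -/
theorem sum_pow_ne_thirtySeven_mul_sq_of_cyclotomicCurves (h : ivorra2007_cyclotomicCurves) {p : ℕ}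
    (hp : p ∈ ({7, 11, 13, 17} : Finset ℕ)) {x y z : ℤ} (hg : Int.gcd (Int.gcd x y) z = 1)
    (hnz : x * y * z ≠ 0) : x ^ p + y ^ p ≠ 37 * z ^ 2 := by
  exact_mod_cast sum_pow_ne_mul_sq_of_cyclotomicCurves h hp (Ivorra2007.admissibleCoeff_thirtySeven_of_mem hp) hg hnz

/-- `39 ∈ 𝔑_p` for every `p ∈ {7, 11, 17}` (`39 = 3·13`; residues `3 ≡ 3, 13 ≡ 6` `(mod 7)`; `3 ≡ 3, 13 ≡ 2` `(mod 11)`; `3 ≡ 3, 13 ≡ 13` `(mod 17)`): rows `C1-C39-even` / `C1-C39-odd` (levels `2·39²`, `2⁵·39²`; `n = 13 ∣ C` excluded by the rows).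
[cite: IvorraKraus2006, p. 119; Ivorra2007, main theorem hypothesis (RatcliffeGrechuk2024 Thm 4.31) (membership 39 ∈ 𝔑_p)] -/
theorem Ivorra2007.admissibleCoeff_thirtyNine_of_mem {p : ℕ} (hp : p ∈ ({7, 11, 17} : Finset ℕ)) :
    Ivorra2007.AdmissibleCoeff p 39 := by
  simp only [Finset.mem_insert, Finset.mem_singleton] at hp
  rcases hp with rfl | rfl | rfl <;> (rw [Ivorra2007.admissibleCoeff_iff_primeFactorsList]; simp)

/-- **The cited cells `x^p + y^p ≠ 39 z²`, `p ∈ {7, 11, 17}`**, for all `(x, y, z)` with `gcd(x, y, z) = 1` and `xyz ≠ 0`,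
GIVEN only the curve fact (rows `C1-C39-even` / `C1-C39-odd` (levels `2·39²`, `2⁵·39²`; `n = 13 ∣ C` excluded by the rows)). Row shape: `sum_pow_ne_mul_sq_of_cyclotomicCurves'` with
`Ivorra2007.admissibleCoeff_thirtyNine_of_mem`. [cite: Ivorra2007, C_p(ℚ), D_p(ℚ) ⇒ S_p(39) = ∅, p ∈ {7, 11, 17} (zbl 1116.11018; IvorraKraus2006 p. 119; RatcliffeGrechuk2024 Thm 4.31)] -/
theorem sum_pow_ne_thirtyNine_mul_sq_of_cyclotomicCurves (h : ivorra2007_cyclotomicCurves) {p : ℕ}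
    (hp : p ∈ ({7, 11, 17} : Finset ℕ)) {x y z : ℤ} (hg : Int.gcd (Int.gcd x y) z = 1)
    (hnz : x * y * z ≠ 0) : x ^ p + y ^ p ≠ 39 * z ^ 2 := by
  have hp' : p ∈ ({7, 11, 13, 17} : Finset ℕ) := by
    simp only [Finset.mem_insert, Finset.mem_singleton] at hp ⊢; tauto
  exact_mod_cast sum_pow_ne_mul_sq_of_cyclotomicCurves h hp' (Ivorra2007.admissibleCoeff_thirtyNine_of_mem hp) hg hnz

/-- `43 ∈ 𝔑_p` for every `p ∈ {11, 13, 17}` (prime; residues `43 ≡ 10` `(mod 11)`; `43 ≡ 4` `(mod 13)`; `43 ≡ 9` `(mod 17)`): rows `C1-C43-even` / `C1-C43-odd` (levels `2·43²`, `2⁵·43²`); NOT `p = 7`: `43 ∉ 𝔑₇` below.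
[cite: Ivorra2007, main theorem hypothesis (RatcliffeGrechuk2024 Thm 4.31) (membership 43 ∈ 𝔑_p)] -/
theorem Ivorra2007.admissibleCoeff_fortyThree_of_mem {p : ℕ} (hp : p ∈ ({11, 13, 17} : Finset ℕ)) :
    Ivorra2007.AdmissibleCoeff p 43 := by
  simp only [Finset.mem_insert, Finset.mem_singleton] at hp
  rcases hp with rfl | rfl | rfl <;> (rw [Ivorra2007.admissibleCoeff_iff_primeFactorsList]; simp)

/-- The boundary: `43 ≡ 1 (mod 7)`, so `43 ∉ 𝔑₇` — the cell `x^7 + y^7 = 43 z²` is OUTSIDE [Ivorra2007] / the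
announced thesis theorem, and a row closing it cannot cite them.
[cite: IvorraKraus2006, p. 119 (non-membership 43 ∉ 𝔑_7: hypothesis fails)] -/
theorem Ivorra2007.not_admissibleCoeff_seven_fortyThree : ¬ Ivorra2007.AdmissibleCoeff 7 43 := by
  rw [Ivorra2007.admissibleCoeff_iff_primeFactorsList]; simp

/-- **The cited cells `x^p + y^p ≠ 43 z²`, `p ∈ {11, 13, 17}`**, for all `(x, y, z)` with `gcd(x, y, z) = 1` and `xyz ≠ 0`,
GIVEN only the curve fact (rows `C1-C43-even` / `C1-C43-odd` (levels `2·43²`, `2⁵·43²`); NOT `p = 7`: `43 ∉ 𝔑₇` below). Row shape: `sum_pow_ne_mul_sq_of_cyclotomicCurves'` with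
`Ivorra2007.admissibleCoeff_fortyThree_of_mem`. [cite: Ivorra2007, C_p(ℚ), D_p(ℚ) ⇒ S_p(43) = ∅, p ∈ {11, 13, 17} (zbl 1116.11018; RatcliffeGrechuk2024 Thm 4.31)] -/
theorem sum_pow_ne_fortyThree_mul_sq_of_cyclotomicCurves (h : ivorra2007_cyclotomicCurves) {p : ℕ}
    (hp : p ∈ ({11, 13, 17} : Finset ℕ)) {x y z : ℤ} (hg : Int.gcd (Int.gcd x y) z = 1)
    (hnz : x * y * z ≠ 0) : x ^ p + y ^ p ≠ 43 * z ^ 2 := by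
  have hp' : p ∈ ({7, 11, 13, 17} : Finset ℕ) := by
    simp only [Finset.mem_insert, Finset.mem_singleton] at hp ⊢; tauto
  exact_mod_cast sum_pow_ne_mul_sq_of_cyclotomicCurves h hp' (Ivorra2007.admissibleCoeff_fortyThree_of_mem hp) hg hnz

/-- `47 ∈ 𝔑_p` for every `p ∈ {7, 11, 13, 17}` (prime; residues `47 ≡ 5` `(mod 7)`; `47 ≡ 3` `(mod 11)`; `47 ≡ 8` `(mod 13)`; `47 ≡ 13` `(mod 17)`): rows `C1-C47-even` / `C1-C47-odd` (levels `2·47²`, `2⁵·47²`).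
[cite: IvorraKraus2006, p. 119; Ivorra2007, main theorem hypothesis (RatcliffeGrechuk2024 Thm 4.31) (membership 47 ∈ 𝔑_p)] -/
theorem Ivorra2007.admissibleCoeff_fortySeven_of_mem {p : ℕ} (hp : p ∈ ({7, 11, 13, 17} : Finset ℕ)) :
    Ivorra2007.AdmissibleCoeff p 47 := by
  simp only [Finset.mem_insert, Finset.mem_singleton] at hp
  rcases hp with rfl | rfl | rfl | rfl <;> (rw [Ivorra2007.admissibleCoeff_iff_primeFactorsList]; simp)

/-- **The cited cells `x^p + y^p ≠ 47 z²`, `p ∈ {7, 11, 13, 17}`**, for all `(x, y, z)` with `gcd(x, y, z) = 1` and `xyz ≠ 0`,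
GIVEN only the curve fact (rows `C1-C47-even` / `C1-C47-odd` (levels `2·47²`, `2⁵·47²`)). Row shape: `sum_pow_ne_mul_sq_of_cyclotomicCurves'` with
`Ivorra2007.admissibleCoeff_fortySeven_of_mem`. [cite: Ivorra2007, C_p(ℚ), D_p(ℚ) ⇒ S_p(47) = ∅, p ∈ {7, 11, 13, 17} (zbl 1116.11018; IvorraKraus2006 p. 119; RatcliffeGrechuk2024 Thm 4.31)] -/
theorem sum_pow_ne_fortySeven_mul_sq_of_cyclotomicCurves (h : ivorra2007_cyclotomicCurves) {p : ℕ}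
    (hp : p ∈ ({7, 11, 13, 17} : Finset ℕ)) {x y z : ℤ} (hg : Int.gcd (Int.gcd x y) z = 1)
    (hnz : x * y * z ≠ 0) : x ^ p + y ^ p ≠ 47 * z ^ 2 := by
  exact_mod_cast sum_pow_ne_mul_sq_of_cyclotomicCurves h hp (Ivorra2007.admissibleCoeff_fortySeven_of_mem hp) hg hnz

/-- `53 ∈ 𝔑_p` for every `p ∈ {7, 11, 17}` (prime; residues `53 ≡ 4` `(mod 7)`; `53 ≡ 9` `(mod 11)`; `53 ≡ 2` `(mod 17)`): row `C1-C53-even` (level `2·53²`); NOT `p = 13`: `53 ∉ 𝔑₁₃` below.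
[cite: IvorraKraus2006, p. 119; Ivorra2007, main theorem hypothesis (RatcliffeGrechuk2024 Thm 4.31) (membership 53 ∈ 𝔑_p)] -/
theorem Ivorra2007.admissibleCoeff_fiftyThree_of_mem {p : ℕ} (hp : p ∈ ({7, 11, 17} : Finset ℕ)) :
    Ivorra2007.AdmissibleCoeff p 53 := by
  simp only [Finset.mem_insert, Finset.mem_singleton] at hp
  rcases hp with rfl | rfl | rfl <;> (rw [Ivorra2007.admissibleCoeff_iff_primeFactorsList]; simp)

/-- The boundary: `53 ≡ 1 (mod 13)`, so `53 ∉ 𝔑₁₃` — the cell `x^13 + y^13 = 53 z²` is OUTSIDE [Ivorra2007] / the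
announced thesis theorem, and a row closing it cannot cite them.
[cite: Ivorra2007, main theorem (RatcliffeGrechuk2024 Thm 4.31) (non-membership 53 ∉ 𝔑_13: hypothesis fails)] -/
theorem Ivorra2007.not_admissibleCoeff_thirteen_fiftyThree : ¬ Ivorra2007.AdmissibleCoeff 13 53 := by
  rw [Ivorra2007.admissibleCoeff_iff_primeFactorsList]; simp

/-- **The cited cells `x^p + y^p ≠ 53 z²`, `p ∈ {7, 11, 17}`**, for all `(x, y, z)` with `gcd(x, y, z) = 1` and `xyz ≠ 0`,
GIVEN only the curve fact (row `C1-C53-even` (level `2·53²`); NOT `p = 13`: `53 ∉ 𝔑₁₃` below). Row shape: `sum_pow_ne_mul_sq_of_cyclotomicCurves'` with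
`Ivorra2007.admissibleCoeff_fiftyThree_of_mem`. [cite: Ivorra2007, C_p(ℚ), D_p(ℚ) ⇒ S_p(53) = ∅, p ∈ {7, 11, 17} (zbl 1116.11018; IvorraKraus2006 p. 119; RatcliffeGrechuk2024 Thm 4.31)] -/
theorem sum_pow_ne_fiftyThree_mul_sq_of_cyclotomicCurves (h : ivorra2007_cyclotomicCurves) {p : ℕ}
    (hp : p ∈ ({7, 11, 17} : Finset ℕ)) {x y z : ℤ} (hg : Int.gcd (Int.gcd x y) z = 1)
    (hnz : x * y * z ≠ 0) : x ^ p + y ^ p ≠ 53 * z ^ 2 := by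
  have hp' : p ∈ ({7, 11, 13, 17} : Finset ℕ) := by
    simp only [Finset.mem_insert, Finset.mem_singleton] at hp ⊢; tauto
  exact_mod_cast sum_pow_ne_mul_sq_of_cyclotomicCurves h hp' (Ivorra2007.admissibleCoeff_fiftyThree_of_mem hp) hg hnz

/-- `59 ∈ 𝔑_p` for every `p ∈ {7, 11, 13, 17}` (prime; residues `59 ≡ 3` `(mod 7)`; `59 ≡ 4` `(mod 11)`; `59 ≡ 7` `(mod 13)`; `59 ≡ 8` `(mod 17)`): row `C1-C59-even` (level `2·59²`).
[cite: IvorraKraus2006, p. 119; Ivorra2007, main theorem hypothesis (RatcliffeGrechuk2024 Thm 4.31) (membership 59 ∈ 𝔑_p)] -/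
theorem Ivorra2007.admissibleCoeff_fiftyNine_of_mem {p : ℕ} (hp : p ∈ ({7, 11, 13, 17} : Finset ℕ)) :
    Ivorra2007.AdmissibleCoeff p 59 := by
  simp only [Finset.mem_insert, Finset.mem_singleton] at hp
  rcases hp with rfl | rfl | rfl | rfl <;> (rw [Ivorra2007.admissibleCoeff_iff_primeFactorsList]; simp)

/-- **The cited cells `x^p + y^p ≠ 59 z²`, `p ∈ {7, 11, 13, 17}`**, for all `(x, y, z)` with `gcd(x, y, z) = 1` and `xyz ≠ 0`,
GIVEN only the curve fact (row `C1-C59-even` (level `2·59²`)). Row shape: `sum_pow_ne_mul_sq_of_cyclotomicCurves'` with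
`Ivorra2007.admissibleCoeff_fiftyNine_of_mem`. [cite: Ivorra2007, C_p(ℚ), D_p(ℚ) ⇒ S_p(59) = ∅, p ∈ {7, 11, 13, 17} (zbl 1116.11018; IvorraKraus2006 p. 119; RatcliffeGrechuk2024 Thm 4.31)] -/
theorem sum_pow_ne_fiftyNine_mul_sq_of_cyclotomicCurves (h : ivorra2007_cyclotomicCurves) {p : ℕ}
    (hp : p ∈ ({7, 11, 13, 17} : Finset ℕ)) {x y z : ℤ} (hg : Int.gcd (Int.gcd x y) z = 1)
    (hnz : x * y * z ≠ 0) : x ^ p + y ^ p ≠ 59 * z ^ 2 := by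
  exact_mod_cast sum_pow_ne_mul_sq_of_cyclotomicCurves h hp (Ivorra2007.admissibleCoeff_fiftyNine_of_mem hp) hg hnz

end CensusCoefficients

/-! ## The batch-C coefficients `C ∈ {30, 41, 51}`: `𝔑_p`-memberships and the cited cells (generic form of the section above)

Appended 2026-08-26 (lit seat g18 of the venture cell `pub-abcsig`, 0 new facts), for the rows of the cell's batch C
(`C1-C30-all`, `C1-C41-odd`, `C1-C51-odd`; `C = 53` is served in `CensusCoefficients`). Same shape and sources as
`CensusCoefficients`: memberships `C ∈ 𝔑_p` by the list criterion `Ivorra2007.admissibleCoeff_iff_primeFactorsList` for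
exactly the exponents `p ∈ {7, 11, 13, 17}` with `p ∤ C` (all four for `30 = 2·3·5` and `41`; `{7, 11, 13}` for
`51 = 3·17`), and one named cell per coefficient from the generic `sum_pow_ne_mul_sq_of_cyclotomicCurves`, GIVEN only
`ivorra2007_cyclotomicCurves`. None of the three has a prime factor `≡ 1 (mod p)` for these `p`, so there is no boundary
non-membership here. Nothing is proved about the curve fact itself; nothing concerns the rows' other exponents.
-/

section CensusCoefficientsBatchC

/-- `30 ∈ 𝔑_p` for every `p ∈ {7, 11, 13, 17}` (`30 = 2·3·5`; residues `2 ≡ 2, 3 ≡ 3, 5 ≡ 5` `(mod 7)`; `2 ≡ 2, 3 ≡ 3, 5 ≡ 5` `(mod 11)`; `2 ≡ 2, 3 ≡ 3, 5 ≡ 5` `(mod 13)`; `2 ≡ 2, 3 ≡ 3, 5 ≡ 5` `(mod 17)`): row `C1-C30-all` (level `2⁸·15²`; even `C`: `x, y` odd forced).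
[cite: IvorraKraus2006, p. 119; Ivorra2007, main theorem hypothesis (RatcliffeGrechuk2024 Thm 4.31) (membership 30 ∈ 𝔑_p)] -/
theorem Ivorra2007.admissibleCoeff_thirty_of_mem {p : ℕ} (hp : p ∈ ({7, 11, 13, 17} : Finset ℕ)) :
    Ivorra2007.AdmissibleCoeff p 30 := by
  simp only [Finset.mem_insert, Finset.mem_singleton] at hp
  rcases hp with rfl | rfl | rfl | rfl <;> (rw [Ivorra2007.admissibleCoeff_iff_primeFactorsList]; simp)

/-- **The cited cells `x^p + y^p ≠ 30 z²`, `p ∈ {7, 11, 13, 17}`**, for all `(x, y, z)` with `gcd(x, y, z) = 1` and `xyz ≠ 0`,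
GIVEN only the curve fact (row `C1-C30-all` (level `2⁸·15²`; even `C`: `x, y` odd forced)). Row shape: `sum_pow_ne_mul_sq_of_cyclotomicCurves'` with
`Ivorra2007.admissibleCoeff_thirty_of_mem`. [cite: Ivorra2007, C_p(ℚ), D_p(ℚ) ⇒ S_p(30) = ∅, p ∈ {7, 11, 13, 17} (zbl 1116.11018; IvorraKraus2006 p. 119; RatcliffeGrechuk2024 Thm 4.31)] -/
theorem sum_pow_ne_thirty_mul_sq_of_cyclotomicCurves (h : ivorra2007_cyclotomicCurves) {p : ℕ}
    (hp : p ∈ ({7, 11, 13, 17} : Finset ℕ)) {x y z : ℤ} (hg : Int.gcd (Int.gcd x y) z = 1)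
    (hnz : x * y * z ≠ 0) : x ^ p + y ^ p ≠ 30 * z ^ 2 := by
  exact_mod_cast sum_pow_ne_mul_sq_of_cyclotomicCurves h hp (Ivorra2007.admissibleCoeff_thirty_of_mem hp) hg hnz

/-- `41 ∈ 𝔑_p` for every `p ∈ {7, 11, 13, 17}` (prime; residues `41 ≡ 6` `(mod 7)`; `41 ≡ 8` `(mod 11)`; `41 ≡ 2` `(mod 13)`; `41 ≡ 7` `(mod 17)`): row `C1-C41-odd` (level `2⁵·41²`; the `xy`-even half `2·41²` is the cell's obstructed case `1 + 2¹⁰ = 41·5²`).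
[cite: IvorraKraus2006, p. 119; Ivorra2007, main theorem hypothesis (RatcliffeGrechuk2024 Thm 4.31) (membership 41 ∈ 𝔑_p)] -/
theorem Ivorra2007.admissibleCoeff_fortyOne_of_mem {p : ℕ} (hp : p ∈ ({7, 11, 13, 17} : Finset ℕ)) :
    Ivorra2007.AdmissibleCoeff p 41 := by
  simp only [Finset.mem_insert, Finset.mem_singleton] at hp
  rcases hp with rfl | rfl | rfl | rfl <;> (rw [Ivorra2007.admissibleCoeff_iff_primeFactorsList]; simp)

/-- **The cited cells `x^p + y^p ≠ 41 z²`, `p ∈ {7, 11, 13, 17}`**, for all `(x, y, z)` with `gcd(x, y, z) = 1` and `xyz ≠ 0`,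
GIVEN only the curve fact (row `C1-C41-odd` (level `2⁵·41²`; the `xy`-even half `2·41²` is the cell's obstructed case `1 + 2¹⁰ = 41·5²`)). Row shape: `sum_pow_ne_mul_sq_of_cyclotomicCurves'` with
`Ivorra2007.admissibleCoeff_fortyOne_of_mem`. [cite: Ivorra2007, C_p(ℚ), D_p(ℚ) ⇒ S_p(41) = ∅, p ∈ {7, 11, 13, 17} (zbl 1116.11018; IvorraKraus2006 p. 119; RatcliffeGrechuk2024 Thm 4.31)] -/
theorem sum_pow_ne_fortyOne_mul_sq_of_cyclotomicCurves (h : ivorra2007_cyclotomicCurves) {p : ℕ}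
    (hp : p ∈ ({7, 11, 13, 17} : Finset ℕ)) {x y z : ℤ} (hg : Int.gcd (Int.gcd x y) z = 1)
    (hnz : x * y * z ≠ 0) : x ^ p + y ^ p ≠ 41 * z ^ 2 := by
  exact_mod_cast sum_pow_ne_mul_sq_of_cyclotomicCurves h hp (Ivorra2007.admissibleCoeff_fortyOne_of_mem hp) hg hnz

/-- `51 ∈ 𝔑_p` for every `p ∈ {7, 11, 13}` (`51 = 3·17`; residues `3 ≡ 3, 17 ≡ 3` `(mod 7)`; `3 ≡ 3, 17 ≡ 6` `(mod 11)`; `3 ≡ 3, 17 ≡ 4` `(mod 13)`): rows `C1-C51-even` / `C1-C51-odd` (levels `2·51²`, `2⁵·51²`; `n = 17 ∣ C` excluded by the rows).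
[cite: IvorraKraus2006, p. 119; Ivorra2007, main theorem hypothesis (RatcliffeGrechuk2024 Thm 4.31) (membership 51 ∈ 𝔑_p)] -/
theorem Ivorra2007.admissibleCoeff_fiftyOne_of_mem {p : ℕ} (hp : p ∈ ({7, 11, 13} : Finset ℕ)) :
    Ivorra2007.AdmissibleCoeff p 51 := by
  simp only [Finset.mem_insert, Finset.mem_singleton] at hp
  rcases hp with rfl | rfl | rfl <;> (rw [Ivorra2007.admissibleCoeff_iff_primeFactorsList]; simp)

/-- **The cited cells `x^p + y^p ≠ 51 z²`, `p ∈ {7, 11, 13}`**, for all `(x, y, z)` with `gcd(x, y, z) = 1` and `xyz ≠ 0`,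
GIVEN only the curve fact (rows `C1-C51-even` / `C1-C51-odd` (levels `2·51²`, `2⁵·51²`; `n = 17 ∣ C` excluded by the rows)). Row shape: `sum_pow_ne_mul_sq_of_cyclotomicCurves'` with
`Ivorra2007.admissibleCoeff_fiftyOne_of_mem`. [cite: Ivorra2007, C_p(ℚ), D_p(ℚ) ⇒ S_p(51) = ∅, p ∈ {7, 11, 13} (zbl 1116.11018; IvorraKraus2006 p. 119; RatcliffeGrechuk2024 Thm 4.31)] -/
theorem sum_pow_ne_fiftyOne_mul_sq_of_cyclotomicCurves (h : ivorra2007_cyclotomicCurves) {p : ℕ}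
    (hp : p ∈ ({7, 11, 13} : Finset ℕ)) {x y z : ℤ} (hg : Int.gcd (Int.gcd x y) z = 1)
    (hnz : x * y * z ≠ 0) : x ^ p + y ^ p ≠ 51 * z ^ 2 := by
  have hp' : p ∈ ({7, 11, 13, 17} : Finset ℕ) := by
    simp only [Finset.mem_insert, Finset.mem_singleton] at hp ⊢; tauto
  exact_mod_cast sum_pow_ne_mul_sq_of_cyclotomicCurves h hp' (Ivorra2007.admissibleCoeff_fiftyOne_of_mem hp) hg hnz

end CensusCoefficientsBatchC

/-! ## The coefficient `C = 58`: `𝔑_p`-memberships, the `n = 7` boundary, and the cited cells (generic form of the sections above)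

Appended 2026-08-26 (lit seat g20 of the venture cell `pub-abcsig`, 0 new facts), for the census cell `C = 58 = 2·29`
(row `C1-C58-all`, single level `2⁸·29²`; even `C`: `x, y` odd forced) opened on 2026-08-26. Same shape and sources as
`CensusCoefficients`: the memberships `58 ∈ 𝔑_p` for `p ∈ {11, 13, 17}` (`2 ≢ 1`; `29 ≡ 7, 3, 12`), PROVED by the list
criterion `Ivorra2007.admissibleCoeff_iff_primeFactorsList`; the boundary NON-membership `58 ∉ 𝔑₇` (`29 ≡ 1 (mod 7)`):
at the cell `x⁷ + y⁷ = 58 z²` neither [Ivorra2007] nor the thesis theorem announced in [IvorraKraus2006, p. 119] applies,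
and a row closing it cannot cite them (venture-cell lit rule §F-C33-n7; the `43 ∉ 𝔑₇` / `53 ∉ 𝔑₁₃` pattern above); and
the cited cells for `p ∈ {11, 13, 17}` GIVEN only `ivorra2007_cyclotomicCurves`. Nothing here is about ABC.
-/

section CensusCoefficientsC58

/-- `58 ∈ 𝔑_p` for every `p ∈ {11, 13, 17}` (`58 = 2·29`; residues `2 ≡ 2, 29 ≡ 7` `(mod 11)`; `2 ≡ 2, 29 ≡ 3` `(mod 13)`; `2 ≡ 2, 29 ≡ 12` `(mod 17)`): row `C1-C58-all` (level `2⁸·29²`; even `C`: `x, y` odd forced); NOT `p = 7`: `58 ∉ 𝔑₇` below.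
[cite: IvorraKraus2006, p. 119; Ivorra2007, main theorem hypothesis (RatcliffeGrechuk2024 Thm 4.31) (membership 58 ∈ 𝔑_p)] -/
theorem Ivorra2007.admissibleCoeff_fiftyEight_of_mem {p : ℕ} (hp : p ∈ ({11, 13, 17} : Finset ℕ)) :
    Ivorra2007.AdmissibleCoeff p 58 := by
  simp only [Finset.mem_insert, Finset.mem_singleton] at hp
  rcases hp with rfl | rfl | rfl <;> (rw [Ivorra2007.admissibleCoeff_iff_primeFactorsList]; simp)

/-- The boundary: `29 ≡ 1 (mod 7)`, so `58 ∉ 𝔑₇` — the cell `x⁷ + y⁷ = 58 z²` is OUTSIDE [Ivorra2007] / the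
announced thesis theorem, and a row closing it cannot cite them.
[cite: Ivorra2007, main theorem (RatcliffeGrechuk2024 Thm 4.31) (non-membership 58 ∉ 𝔑_7: hypothesis fails)] -/
theorem Ivorra2007.not_admissibleCoeff_seven_fiftyEight : ¬ Ivorra2007.AdmissibleCoeff 7 58 := by
  rw [Ivorra2007.admissibleCoeff_iff_primeFactorsList]; simp

/-- **The cited cells `x^p + y^p ≠ 58 z²`, `p ∈ {11, 13, 17}`**, for all `(x, y, z)` with `gcd(x, y, z) = 1` and `xyz ≠ 0`,
GIVEN only the curve fact (row `C1-C58-all` (level `2⁸·29²`; even `C`: `x, y` odd forced); NOT `p = 7`: `58 ∉ 𝔑₇` above). Row shape: `sum_pow_ne_mul_sq_of_cyclotomicCurves'` with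
`Ivorra2007.admissibleCoeff_fiftyEight_of_mem`. [cite: Ivorra2007, C_p(ℚ), D_p(ℚ) ⇒ S_p(58) = ∅, p ∈ {11, 13, 17} (zbl 1116.11018; RatcliffeGrechuk2024 Thm 4.31)] -/
theorem sum_pow_ne_fiftyEight_mul_sq_of_cyclotomicCurves (h : ivorra2007_cyclotomicCurves) {p : ℕ}
    (hp : p ∈ ({11, 13, 17} : Finset ℕ)) {x y z : ℤ} (hg : Int.gcd (Int.gcd x y) z = 1)
    (hnz : x * y * z ≠ 0) : x ^ p + y ^ p ≠ 58 * z ^ 2 := by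
  have hp' : p ∈ ({7, 11, 13, 17} : Finset ℕ) := by
    simp only [Finset.mem_insert, Finset.mem_singleton] at hp ⊢; tauto
  exact_mod_cast sum_pow_ne_mul_sq_of_cyclotomicCurves h hp' (Ivorra2007.admissibleCoeff_fiftyEight_of_mem hp) hg hnz

end CensusCoefficientsC58


end Literature.NumberTheory.DiophantineGeometry
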